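import Literature.NumberTheory.LFunctions.BCHDiagonalSum
import HarnessLib

/-!
# Lattice points in a hyperbola strip cut by a wedge (the `k' ∣ μ` count of the BCH cross term)

Topic `Literature/NumberTheory/LFunctions`. Everything in this file is PROVED (no named facts; the
only definition is the transparent finite set `BCH.wedgeNu`).

In the main sum of the cross term of the Balasubramanian–Conrey–Heath-Brown mean square, the `μ`
divisible by `k' = k/(h,k)`, `μ = k'ρ`, carry the phase `e^{-ic} = 1` and contribute the number of
lattice points `(ρ, ν)` with
`T/(2πh') ≤ ρν ≤ T'/(2πh')`, `ρk'² ≤ νh'`, `ν ≤ ρh'` (`h' = h/(h,k)`):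
a hyperbola strip cut by the wedge of slopes `k'²/h' ≤ ν/ρ ≤ h'`. On a short block
`T' ≤ (1+η)T` this count is `(T'−T)/(2πh') · log(h'/k')` up to `O(η (T'−T)/h' + η√T + √T)`:
in the middle range `√(T'/2π)/h' ≤ ρ ≤ √(T/2π)/k'` the wedge is inactive and each `ρ` carries
`(T'−T)/(2πh'ρ) + O(1)` points; the two edge ranges have relative length `O(η)`.

* `BCH.card_filter_real_Icc` — `#{ν ∈ ℕ ∩ [1, X] : L ≤ ν ≤ U}` is within `1` of `U − L` (for
  `0 < L`, `U ≤ X`... see the statement);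
* `BCH.wedgeNu_card_mid`, `BCH.wedgeNu_card_le`, `BCH.wedgeNu_eq_empty` — the three ranges of `ρ`;
* `BCH.abs_wedgeCount_sub_main_le` — **the count**:
  `|Σ_ρ #wedgeNu(ρ) − (T'−T)/(2πh') log(h'/k')| ≤ 3η(T'−T)/(2πh') + 8(T'−T)/√(2πT) + 2√(T'/2π) + 8`
  for `0 < T ≤ T' ≤ 2T`, `1 ≤ k' ≤ h'`, `√(T'/2π) ≥ 2h'`, `η = (T'−T)/T`.

## References

* [Titchmarsh1986] E. C. Titchmarsh, *The Theory of the Riemann Zeta-Function*, 2nd ed. (1986), §9.22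
  (the lattice-point evaluation of `Σ_{k ∣ m} r`).
* [Levinson1974] N. Levinson, Adv. Math. 13 (1974), §§5–6.
-/

noncomputable section

open Finset Real

namespace Literature.NumberTheory.LFunctions.BCH

/-! ### Integers in a real interval -/

/-- `{ν ∈ [1,X] : L ≤ ν ≤ U} ⊆ [⌈L⌉, ⌊U⌋]` for `0 ≤ U`. [folklore] -/
theorem filter_real_subset_Icc {L U : ℝ} (X : ℕ) (_hU0 : 0 ≤ U) :
    (Finset.Icc 1 X).filter (fun ν : ℕ => L ≤ ν ∧ (ν : ℝ) ≤ U) ⊆ Finset.Icc ⌈L⌉₊ ⌊U⌋₊ := by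
  intro ν hν
  simp only [Finset.mem_filter, Finset.mem_Icc] at hν ⊢
  exact ⟨Nat.ceil_le.2 hν.2.1, Nat.le_floor hν.2.2⟩

/-- `#{ν ∈ [1,X] : L ≤ ν ≤ U} ≤ U − L + 1` for `0 < L ≤ U` (any `X`). [folklore] -/
theorem card_filter_real_le {L U : ℝ} (X : ℕ) (hL : 0 < L) (hLU : L ≤ U) :
    (((Finset.Icc 1 X).filter (fun ν : ℕ => L ≤ ν ∧ (ν : ℝ) ≤ U)).card : ℝ) ≤ U - L + 1 := by
  have hU0 : 0 ≤ U := hL.le.trans hLU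
  have h1 := Finset.card_le_card (filter_real_subset_Icc (L := L) X hU0)
  rw [Nat.card_Icc] at h1
  have hceil' := Nat.le_ceil L
  have hfloor := Nat.floor_le hU0
  have h2 : (((Finset.Icc 1 X).filter (fun ν : ℕ => L ≤ ν ∧ (ν : ℝ) ≤ U)).card : ℝ) ≤
      ((⌊U⌋₊ + 1 - ⌈L⌉₊ : ℕ) : ℝ) := by exact_mod_cast h1
  refine h2.trans ?_
  rcases le_or_gt ⌈L⌉₊ (⌊U⌋₊ + 1) with hle | hlt
  · rw [Nat.cast_sub hle]; push_cast; linarith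
  · rw [Nat.sub_eq_zero_of_le hlt.le]; push_cast; linarith

/-- `{ν ∈ [1,X] : L ≤ ν ≤ U} = [⌈L⌉, ⌊U⌋]` for `0 < L` and `0 ≤ U < X + 1`. [folklore] -/
theorem filter_real_eq_Icc {L U : ℝ} {X : ℕ} (hL : 0 < L) (hU0 : 0 ≤ U) (hU : U < X + 1) :
    (Finset.Icc 1 X).filter (fun ν : ℕ => L ≤ ν ∧ (ν : ℝ) ≤ U) = Finset.Icc ⌈L⌉₊ ⌊U⌋₊ := by
  refine Finset.Subset.antisymm (filter_real_subset_Icc X hU0) ?_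
  intro ν hν
  simp only [Finset.mem_filter, Finset.mem_Icc] at hν ⊢
  have hν1 : L ≤ ν := (Nat.le_ceil L).trans (by exact_mod_cast hν.1)
  have hν2 : (ν : ℝ) ≤ U := le_trans (by exact_mod_cast hν.2) (Nat.floor_le hU0)
  refine ⟨⟨?_, ?_⟩, hν1, hν2⟩
  · have : (0 : ℝ) < ν := hL.trans_le hν1
    exact_mod_cast (show 0 < ν by exact_mod_cast this)
  · have : (ν : ℝ) < X + 1 := hν2.trans_lt hU
    have : ν < X + 1 := by exact_mod_cast this
    omega

/-- The integers `ν` with `L ≤ ν ≤ U` inside `[1, X]`: if `0 < L ≤ U < X + 1` then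
`#{ν ∈ [1,X] : L ≤ ν ≤ U} = ⌊U⌋ − ⌈L⌉ + 1 ∈ [U − L − 1, U − L + 1]`. [folklore] -/
theorem card_filter_real_Icc {L U : ℝ} {X : ℕ} (hL : 0 < L) (hLU : L ≤ U) (hU : U < X + 1) :
    (U - L - 1 ≤ (((Finset.Icc 1 X).filter (fun ν : ℕ => L ≤ ν ∧ (ν : ℝ) ≤ U)).card : ℝ)) ∧
      ((((Finset.Icc 1 X).filter (fun ν : ℕ => L ≤ ν ∧ (ν : ℝ) ≤ U)).card : ℝ) ≤ U - L + 1) := by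
  refine ⟨?_, card_filter_real_le X hL hLU⟩
  have hU0 : 0 ≤ U := hL.le.trans hLU
  rw [filter_real_eq_Icc hL hU0 hU, Nat.card_Icc]
  have hceil := Nat.ceil_lt_add_one hL.le
  have hfloor' := Nat.lt_floor_add_one U
  have hle : ⌈L⌉₊ ≤ ⌊U⌋₊ + 1 := by
    by_contra hlt
    push Not at hlt
    have : ((⌊U⌋₊ + 1 : ℕ) : ℝ) + 1 ≤ ⌈L⌉₊ := by exact_mod_cast hlt
    push_cast at this
    linarith
  rw [Nat.cast_sub hle]
  push_cast
  linarith

/-! ### Harmonic sums over an interval -/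

/-- `Σ_{p ≤ ρ ≤ q} 1/ρ = H_q − H_{p−1}` for `1 ≤ p ≤ q + 1`. [folklore] -/
theorem sum_Icc_one_div_eq {p q : ℕ} (hp : 1 ≤ p) (hpq : p ≤ q + 1) :
    ∑ ρ ∈ Finset.Icc p q, 1 / (ρ : ℝ) = harmonicR q - harmonicR (p - 1) := by
  rw [harmonicR, harmonicR]
  have e1 : Finset.Icc 1 q = Finset.Ioc 0 q := by ext n; simp only [Finset.mem_Icc, Finset.mem_Ioc]; omega
  have e2 : Finset.Icc 1 (p - 1) = Finset.Ioc 0 (p - 1) := by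
    ext n; simp only [Finset.mem_Icc, Finset.mem_Ioc]; omega
  have e3 : Finset.Icc p q = Finset.Ioc (p - 1) q := by
    ext n; simp only [Finset.mem_Icc, Finset.mem_Ioc]; omega
  rw [e1, e2, e3, ← Finset.sum_Ioc_consecutive _ (Nat.zero_le (p - 1)) (by omega : p - 1 ≤ q)]
  ring

/-- `|H_q − H_{p−1} − log(q/(p−1))| ≤ 1/(2(p−1))` for `2 ≤ p ≤ q + 1` (from the two-sided bounds
`H_n = log n + γ + 1/(2n) + O⁻(1/(8n²))`). [folklore] -/
theorem abs_harmonicR_sub_sub_log_le {p q : ℕ} (hp : 2 ≤ p) (hpq : p ≤ q + 1) :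
    |harmonicR q - harmonicR (p - 1) - Real.log ((q : ℝ) / (p - 1 : ℕ))| ≤ 1 / (2 * ((p - 1 : ℕ) : ℝ)) := by
  have hp1 : 1 ≤ p - 1 := by omega
  have hq1 : 1 ≤ q := by omega
  have hpR : (1 : ℝ) ≤ (p - 1 : ℕ) := by exact_mod_cast hp1
  have hqR : (1 : ℝ) ≤ q := by exact_mod_cast hq1
  have hpq' : ((p - 1 : ℕ) : ℝ) ≤ q := by exact_mod_cast (by omega : p - 1 ≤ q)
  have u1 := harmonicR_le hq1
  have l1 := le_harmonicR hq1
  have u2 := harmonicR_le hp1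
  have l2 := le_harmonicR hp1
  rw [Real.log_div (by positivity) (by positivity)]
  have hq8 : 1 / (8 * (q : ℝ) ^ 2) ≤ 1 / (2 * q) := by
    rw [div_le_div_iff₀ (by positivity) (by positivity)]; nlinarith
  have hp8 : 1 / (8 * ((p - 1 : ℕ) : ℝ) ^ 2) ≤ 1 / (2 * ((p - 1 : ℕ) : ℝ)) := by
    rw [div_le_div_iff₀ (by positivity) (by positivity)]; nlinarith
  have hqp : 1 / (2 * (q : ℝ)) ≤ 1 / (2 * ((p - 1 : ℕ) : ℝ)) :=
    div_le_div_of_nonneg_left (by norm_num) (by positivity) (by linarith)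
  rw [abs_le]
  constructor <;> nlinarith

/-- `|log(⌊Q⌋/(⌈P⌉−1)) − log(Q/P)| ≤ 1/⌊Q⌋ + 1/(⌈P⌉−1)` for `2 ≤ P`, `1 ≤ Q`. [folklore] -/
theorem abs_log_floor_div_sub_le {P Q : ℝ} (hP : 2 ≤ P) (hQ : 1 ≤ Q) :
    |Real.log ((⌊Q⌋₊ : ℝ) / (⌈P⌉₊ - 1 : ℕ)) - Real.log (Q / P)| ≤
      1 / (⌊Q⌋₊ : ℝ) + 1 / ((⌈P⌉₊ - 1 : ℕ) : ℝ) := by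
  have hq1 : 1 ≤ ⌊Q⌋₊ := Nat.le_floor (by exact_mod_cast hQ)
  have hqR : (1 : ℝ) ≤ ⌊Q⌋₊ := by exact_mod_cast hq1
  have hp2 : 2 ≤ ⌈P⌉₊ := by
    have := Nat.lt_ceil.2 (show ((1 : ℕ) : ℝ) < P by push_cast; linarith)
    omega
  have hp1R : (1 : ℝ) ≤ (⌈P⌉₊ - 1 : ℕ) := by exact_mod_cast (by omega : 1 ≤ ⌈P⌉₊ - 1)
  have hQ0 : 0 < Q := by linarith
  have hP0 : 0 < P := by linarith
  -- `q ≤ Q < q + 1`, `p − 1 < P ≤ p`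
  have hq_le : (⌊Q⌋₊ : ℝ) ≤ Q := Nat.floor_le hQ0.le
  have hq_lt : Q < ⌊Q⌋₊ + 1 := Nat.lt_floor_add_one Q
  have hp_le : P ≤ ⌈P⌉₊ := Nat.le_ceil P
  have hp_lt : ((⌈P⌉₊ - 1 : ℕ) : ℝ) < P := by
    have := Nat.ceil_lt_add_one hP0.le
    rw [Nat.cast_sub (by omega)]
    push_cast
    linarith
  rw [Real.log_div (by positivity) (by positivity), Real.log_div hQ0.ne' hP0.ne']
  -- `0 ≤ log Q − log q ≤ 1/q` and `0 ≤ log P − log (p−1) ≤ 1/(p−1)`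
  have a1 : Real.log ⌊Q⌋₊ ≤ Real.log Q := Real.log_le_log (by positivity) hq_le
  have a2 : Real.log Q ≤ Real.log ⌊Q⌋₊ + 1 / ⌊Q⌋₊ := by
    have h1 : Real.log Q ≤ Real.log ((⌊Q⌋₊ : ℝ) + 1) := Real.log_le_log hQ0 hq_lt.le
    have h2 : Real.log ((⌊Q⌋₊ : ℝ) + 1) - Real.log ⌊Q⌋₊ ≤ 1 / ⌊Q⌋₊ := by
      rw [← Real.log_div (by positivity) (by positivity)]
      refine (Real.log_le_sub_one_of_pos (by positivity)).trans (le_of_eq ?_)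
      field_simp
      ring
    linarith
  have b1 : Real.log ((⌈P⌉₊ - 1 : ℕ) : ℝ) ≤ Real.log P := Real.log_le_log (by positivity) hp_lt.le
  have b2 : Real.log P ≤ Real.log ((⌈P⌉₊ - 1 : ℕ) : ℝ) + 1 / ((⌈P⌉₊ - 1 : ℕ) : ℝ) := by
    have h1 : Real.log P ≤ Real.log (((⌈P⌉₊ - 1 : ℕ) : ℝ) + 1) := by
      refine Real.log_le_log hP0 ?_
      rw [Nat.cast_sub (by omega)]; push_cast; linarith
    have h2 : Real.log (((⌈P⌉₊ - 1 : ℕ) : ℝ) + 1) - Real.log ((⌈P⌉₊ - 1 : ℕ) : ℝ) ≤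
        1 / ((⌈P⌉₊ - 1 : ℕ) : ℝ) := by
      rw [← Real.log_div (by positivity) (by positivity)]
      refine (Real.log_le_sub_one_of_pos (by positivity)).trans (le_of_eq ?_)
      field_simp
      ring
    linarith
  have c1 : 0 < 1 / (⌊Q⌋₊ : ℝ) := by positivity
  have c2 : 0 < 1 / ((⌈P⌉₊ - 1 : ℕ) : ℝ) := by positivity
  rw [abs_le]; constructor <;> linarith

/-- **The middle-range harmonic sum**: for `2 ≤ P ≤ Q < X + 1`,
`|Σ_{ρ ∈ [1,X], P ≤ ρ ≤ Q} 1/ρ − log(Q/P)| ≤ 5/P`. [folklore] -/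
theorem abs_sum_mid_inv_sub_log_le {P Q : ℝ} {X : ℕ} (hP : 2 ≤ P) (hPQ : P ≤ Q) (hQX : Q < X + 1) :
    |∑ ρ ∈ (Finset.Icc 1 X).filter (fun ρ : ℕ => P ≤ ρ ∧ (ρ : ℝ) ≤ Q), 1 / (ρ : ℝ) - Real.log (Q / P)| ≤
      5 / P := by
  have hP0 : 0 < P := by linarith
  have hQ1 : 1 ≤ Q := by linarith
  rw [filter_real_eq_Icc hP0 (by linarith) hQX]
  set p := ⌈P⌉₊ with hp
  set q := ⌊Q⌋₊ with hq
  have hp2 : 2 ≤ p := by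
    have := Nat.lt_ceil.2 (show ((1 : ℕ) : ℝ) < P by push_cast; linarith)
    omega
  have hpq : p ≤ q + 1 := by
    -- `⌈P⌉ ≤ ⌈Q⌉ ≤ ⌊Q⌋ + 1`
    have h1 : p ≤ ⌈Q⌉₊ := Nat.ceil_mono hPQ
    have h2 : ⌈Q⌉₊ ≤ q + 1 := Nat.ceil_le_floor_add_one Q
    omega
  rw [sum_Icc_one_div_eq (by omega) hpq]
  have e1 := abs_harmonicR_sub_sub_log_le hp2 hpq
  have e2 := abs_log_floor_div_sub_le hP hQ1
  rw [← hp, ← hq] at e2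
  -- `1/(p−1) ≤ 2/P`, `1/q ≤ 2/P`
  have hp1R : ((p - 1 : ℕ) : ℝ) ≥ P / 2 := by
    have := Nat.le_ceil P
    rw [Nat.cast_sub (by omega)]; push_cast; rw [hp]; linarith
  have hqR : (q : ℝ) ≥ P / 2 := by
    have : ((p - 1 : ℕ) : ℝ) ≤ q := by exact_mod_cast (by omega : p - 1 ≤ q)
    linarith
  have hp1pos : (0 : ℝ) < ((p - 1 : ℕ) : ℝ) := by linarith
  have hqpos : (0 : ℝ) < q := by linarith
  have i1 : 1 / ((p - 1 : ℕ) : ℝ) ≤ 2 / P := by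
    rw [div_le_div_iff₀ hp1pos hP0]; linarith
  have i2 : 1 / (q : ℝ) ≤ 2 / P := by
    rw [div_le_div_iff₀ hqpos hP0]; linarith
  have i3 : 1 / (2 * ((p - 1 : ℕ) : ℝ)) ≤ 1 / P := by
    rw [div_le_div_iff₀ (by linarith) hP0]; linarith
  have := abs_sub_le (harmonicR q - harmonicR (p - 1)) (Real.log ((q : ℝ) / (p - 1 : ℕ))) (Real.log (Q / P))
  have e5 : 2 / P + 2 / P + 1 / P = 5 / P := by ring
  linarith [abs_nonneg (Real.log ((q : ℝ) / (p - 1 : ℕ)) - Real.log (Q / P))]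

/-! ### The switched-on `ν` for `μ = k'ρ` -/

/-- The `ν ∈ [1, X]` switched on against `μ = k'ρ` for the reduced pair `(h', k')`:
`T/(2πh') ≤ ρν ≤ T'/(2πh')`, `ρk'² ≤ νh'`, `ν ≤ ρh'`. [cite: Titchmarsh1986, §9.22] -/
def wedgeNu (T T' : ℝ) (X h' k' ρ : ℕ) : Finset ℕ :=
  (Finset.Icc 1 X).filter fun ν =>
    T / (2 * π * h') ≤ (ρ : ℝ) * ν ∧ (ρ : ℝ) * ν ≤ T' / (2 * π * h') ∧ ρ * k' ^ 2 ≤ ν * h' ∧ ν ≤ ρ * h'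

/-- Membership in `wedgeNu`. [folklore] -/
theorem mem_wedgeNu {T T' : ℝ} {X h' k' ρ ν : ℕ} : ν ∈ wedgeNu T T' X h' k' ρ ↔
    ν ∈ Finset.Icc 1 X ∧ (T / (2 * π * h') ≤ (ρ : ℝ) * ν ∧ (ρ : ℝ) * ν ≤ T' / (2 * π * h') ∧
      ρ * k' ^ 2 ≤ ν * h' ∧ ν ≤ ρ * h') := by
  rw [wedgeNu, Finset.mem_filter]

/-- `wedgeNu ⊆` the hyperbola strip `{ν ∈ [1,X] : a/ρ ≤ ν ≤ a'/ρ}`, `a = T/(2πh')`, `a' = T'/(2πh')`.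
[folklore] -/
theorem wedgeNu_subset_strip (T T' : ℝ) (X h' k' : ℕ) {ρ : ℕ} (hρ : 0 < ρ) :
    wedgeNu T T' X h' k' ρ ⊆ (Finset.Icc 1 X).filter
      (fun ν : ℕ => T / (2 * π * h') / ρ ≤ ν ∧ (ν : ℝ) ≤ T' / (2 * π * h') / ρ) := by
  intro ν hν
  rw [mem_wedgeNu] at hν
  have hρR : (0 : ℝ) < ρ := by exact_mod_cast hρ
  simp only [Finset.mem_filter]
  refine ⟨hν.1, ?_, ?_⟩
  · rw [div_le_iff₀ hρR]; linarith [hν.2.1]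
  · rw [le_div_iff₀ hρR]; linarith [hν.2.2.1]

/-- **Middle range**: if `T' ≤ 2πh'²ρ²` and `2πk'²ρ² ≤ T` (and `X = ⌊√(T'/2π)⌋`), the wedge is
inactive: `wedgeNu = {ν ∈ [1,X] : a/ρ ≤ ν ≤ a'/ρ}`. [cite: Titchmarsh1986, §9.22] -/
theorem wedgeNu_eq_strip {T T' : ℝ} {X h' k' ρ : ℕ} (hh' : 0 < h')
    (hρ : 0 < ρ) (hlow : T' ≤ 2 * π * (h' : ℝ) ^ 2 * (ρ : ℝ) ^ 2)
    (hhigh : 2 * π * (k' : ℝ) ^ 2 * (ρ : ℝ) ^ 2 ≤ T) :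
    wedgeNu T T' X h' k' ρ = (Finset.Icc 1 X).filter
      (fun ν : ℕ => T / (2 * π * h') / ρ ≤ ν ∧ (ν : ℝ) ≤ T' / (2 * π * h') / ρ) := by
  refine Finset.Subset.antisymm (wedgeNu_subset_strip T T' X h' k' hρ) ?_
  intro ν hν
  simp only [Finset.mem_filter] at hν
  have hρR : (0 : ℝ) < ρ := by exact_mod_cast hρ
  have hh'R : (0 : ℝ) < h' := by exact_mod_cast hh'
  have hπ := Real.pi_pos
  have h1 : T / (2 * π * h') ≤ (ρ : ℝ) * ν := by
    have := hν.2.1; rw [div_le_iff₀ hρR] at this; linarith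
  have h2 : (ρ : ℝ) * ν ≤ T' / (2 * π * h') := by
    have := hν.2.2; rw [le_div_iff₀ hρR] at this; linarith
  rw [mem_wedgeNu]
  refine ⟨hν.1, h1, h2, ?_, ?_⟩
  · -- `ρk'² ≤ νh'`: `νh' ≥ T/(2πρ) ≥ k'²ρ`
    have key : (ρ : ℝ) * k' ^ 2 ≤ ν * h' := by
      have e1 : T / (2 * π) ≤ (ρ : ℝ) * ν * h' := by
        rw [div_le_iff₀ (by positivity)] at h1 ⊢; nlinarith
      have hA : (k' : ℝ) ^ 2 * (ρ : ℝ) ^ 2 ≤ T / (2 * π) := by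
        rw [le_div_iff₀ (by positivity)]; linarith
      have hB : (ρ : ℝ) * ((ρ : ℝ) * k' ^ 2) ≤ ρ * (ν * h') := by
        have : (ρ : ℝ) * ((ρ : ℝ) * k' ^ 2) = (k' : ℝ) ^ 2 * (ρ : ℝ) ^ 2 := by ring
        rw [this]; linarith
      exact le_of_mul_le_mul_left hB hρR
    exact_mod_cast key
  · -- `ν ≤ ρh'`: `ν ≤ T'/(2πh'ρ) ≤ ρh'`
    have key : (ν : ℝ) ≤ ρ * h' := by
      have e1 : (ρ : ℝ) * ν * h' ≤ T' / (2 * π) := by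
        rw [le_div_iff₀ (by positivity)] at h2 ⊢; nlinarith
      have e2 : T' / (2 * π) ≤ (h' : ℝ) ^ 2 * (ρ : ℝ) ^ 2 := by
        rw [div_le_iff₀ (by positivity)]; nlinarith
      have hB : ((ρ : ℝ) * h') * ν ≤ ((ρ : ℝ) * h') * (ρ * h') := by
        have e3 : ((ρ : ℝ) * h') * ν = (ρ : ℝ) * ν * h' := by ring
        have e4 : ((ρ : ℝ) * h') * (ρ * h') = (h' : ℝ) ^ 2 * (ρ : ℝ) ^ 2 := by ring
        rw [e3, e4]; linarith
      exact le_of_mul_le_mul_left hB (by positivity)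
    exact_mod_cast key

/-- **Outside**: if `2πh'²ρ² < T` or `T' < 2πk'²ρ²` then `wedgeNu = ∅`. [folklore] -/
theorem wedgeNu_eq_empty {T T' : ℝ} {X h' k' ρ : ℕ} (hh' : 0 < h')
    (hout : 2 * π * (h' : ℝ) ^ 2 * (ρ : ℝ) ^ 2 < T ∨ T' < 2 * π * (k' : ℝ) ^ 2 * (ρ : ℝ) ^ 2) :
    wedgeNu T T' X h' k' ρ = ∅ := by
  rw [Finset.eq_empty_iff_forall_notMem]
  intro ν hν
  rw [mem_wedgeNu] at hν
  obtain ⟨-, h1, h2, h3, h4⟩ := hν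
  have hh'R : (0 : ℝ) < h' := by exact_mod_cast hh'
  have hπ := Real.pi_pos
  have h3R : (ρ : ℝ) * k' ^ 2 ≤ ν * h' := by exact_mod_cast h3
  have h4R : (ν : ℝ) ≤ ρ * h' := by exact_mod_cast h4
  have hρ0 : (0 : ℝ) ≤ ρ := Nat.cast_nonneg ρ
  rcases hout with hlt | hlt
  · -- `T ≤ 2πh' ρν ≤ 2πh'²ρ²`
    rw [div_le_iff₀ (by positivity)] at h1
    have := mul_le_mul_of_nonneg_left h4R (by positivity : (0 : ℝ) ≤ 2 * π * h' * ρ)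
    nlinarith [this]
  · rw [le_div_iff₀ (by positivity)] at h2
    have := mul_le_mul_of_nonneg_left h3R (by positivity : (0 : ℝ) ≤ 2 * π * ρ)
    nlinarith [this]

/-- **Any `ρ`**: `#wedgeNu ≤ (a' − a)/ρ + 1`. [folklore] -/
theorem card_wedgeNu_le {T T' : ℝ} (hT : 0 < T) (hTT' : T ≤ T') (X : ℕ) {h' : ℕ} (hh' : 0 < h')
    (k' : ℕ) {ρ : ℕ} (hρ : 0 < ρ) :
    ((wedgeNu T T' X h' k' ρ).card : ℝ) ≤ (T' / (2 * π * h') - T / (2 * π * h')) / ρ + 1 := by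
  have hρR : (0 : ℝ) < ρ := by exact_mod_cast hρ
  have hh'R : (0 : ℝ) < h' := by exact_mod_cast hh'
  have h1 := Finset.card_le_card (wedgeNu_subset_strip T T' X h' k' hρ)
  have h2 := card_filter_real_le (L := T / (2 * π * h') / ρ) (U := T' / (2 * π * h') / ρ) X
    (by positivity) (div_le_div_of_nonneg_right (div_le_div_of_nonneg_right hTT' (by positivity)) hρR.le)
  calc ((wedgeNu T T' X h' k' ρ).card : ℝ) ≤ _ := by exact_mod_cast h1
    _ ≤ _ := h2
    _ = _ := by rw [sub_div]

/-! ### The count -/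

/-- `√(T'/2π) − √(T/2π) ≤ (η/2)√(T/2π)`, `η = (T'−T)/T`. [folklore] -/
theorem sqrt_sub_sqrt_le {T T' : ℝ} (hT : 0 < T) (hTT' : T ≤ T') :
    Real.sqrt (T' / (2 * π)) - Real.sqrt (T / (2 * π)) ≤
      (T' - T) / T / 2 * Real.sqrt (T / (2 * π)) := by
  have hπ := Real.pi_pos
  have hT' : 0 < T' := by linarith
  set V := Real.sqrt (T' / (2 * π)) with hV
  set W := Real.sqrt (T / (2 * π)) with hW
  have hW0 : 0 < W := Real.sqrt_pos.2 (by positivity)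
  have hWV : W ≤ V := Real.sqrt_le_sqrt (by gcongr)
  have hV2 : V ^ 2 = T' / (2 * π) := Real.sq_sqrt (by positivity)
  have hW2 : W ^ 2 = T / (2 * π) := Real.sq_sqrt (by positivity)
  have key : (V - W) * (2 * W) ≤ V ^ 2 - W ^ 2 := by nlinarith
  have e : (T' - T) / T / 2 * W * (2 * W) = V ^ 2 - W ^ 2 := by
    rw [hV2, hW2]
    have hT2 : T = 2 * π * W ^ 2 := by rw [hW2]; field_simp
    have hW2' : W ^ 2 = T / (2 * π) := hW2
    field_simp
    nlinarith [hW2']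
  nlinarith [e, key, hW0]

set_option maxHeartbeats 1600000 in
/-- **Lattice points in the hyperbola strip cut by the wedge.** For `0 < T ≤ T' ≤ 2T`,
`1 ≤ k' ≤ h'`, `√(T'/2π) ≥ 2h'` and `X = ⌊√(T'/2π)⌋`:
`|Σ_{ρ ≤ X} #wedgeNu(ρ) − (T'−T)/(2πh') · log(h'/k')|`
`  ≤ 2η (T'−T)/(2πh') + 7 (T'−T)/√(2πT) + 2√(T'/2π) + 2`, `η = (T'−T)/T`.
[cite: Titchmarsh1986, §9.22] -/
theorem abs_wedgeCount_sub_main_le {T T' : ℝ} (hT : 0 < T) (hTT' : T ≤ T') (hT'2 : T' ≤ 2 * T)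
    {h' k' : ℕ} (hk' : 0 < k') (hk'h' : k' ≤ h') (hP : 2 * (h' : ℝ) ≤ Real.sqrt (T' / (2 * π))) :
    |∑ ρ ∈ Finset.Icc 1 ⌊Real.sqrt (T' / (2 * π))⌋₊,
        ((wedgeNu T T' ⌊Real.sqrt (T' / (2 * π))⌋₊ h' k' ρ).card : ℝ) -
        (T' - T) / (2 * π * h') * Real.log ((h' : ℝ) / k')| ≤
      2 * ((T' - T) / T) * ((T' - T) / (2 * π * h')) + 7 * ((T' - T) / Real.sqrt (2 * π * T)) +
        2 * Real.sqrt (T' / (2 * π)) + 2 := by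
  have hπ := Real.pi_pos
  have hT' : 0 < T' := by linarith
  have hh' : 0 < h' := lt_of_lt_of_le hk' hk'h'
  have hh'R : (0 : ℝ) < h' := by exact_mod_cast hh'
  have hk'R : (0 : ℝ) < k' := by exact_mod_cast hk'
  have hk'h'R : (k' : ℝ) ≤ h' := by exact_mod_cast hk'h'
  have hk'1 : (1 : ℝ) ≤ k' := by exact_mod_cast hk'
  -- the players
  set V := Real.sqrt (T' / (2 * π)) with hV
  set W := Real.sqrt (T / (2 * π)) with hW
  set X := ⌊V⌋₊ with hX
  set A := (T' - T) / (2 * π * h') with hA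
  set η := (T' - T) / T with hη
  set D₁ := (T' - T) / Real.sqrt (2 * π * T) with hD₁
  set P := V / h' with hPdef
  set P₀ := W / h' with hP₀
  set Q := W / k' with hQ
  set Q' := V / k' with hQ'
  have hV0 : 0 < V := Real.sqrt_pos.2 (by positivity)
  have hW0 : 0 < W := Real.sqrt_pos.2 (by positivity)
  have hWV : W ≤ V := Real.sqrt_le_sqrt (by gcongr)
  have hV2 : V ^ 2 = T' / (2 * π) := Real.sq_sqrt (by positivity)
  have hW2 : W ^ 2 = T / (2 * π) := Real.sq_sqrt (by positivity)
  have hT'0 : 0 ≤ T' - T := by linarith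
  have hA0 : 0 ≤ A := by positivity
  have hη0 : 0 ≤ η := by positivity
  have hη1 : η ≤ 1 := by rw [hη, div_le_one hT]; linarith
  have hD₁0 : 0 ≤ D₁ := by positivity
  have hP2 : 2 ≤ P := by rw [hPdef, le_div_iff₀ hh'R]; linarith
  have hP0' : 0 < P := by linarith
  have hP0pos : 0 < P₀ := by positivity
  have hQpos : 0 < Q := by positivity
  have hXV : V < X + 1 := Nat.lt_floor_add_one V
  have hXV' : (X : ℝ) ≤ V := Nat.floor_le hV0.le
  have hQW : Q ≤ W := div_le_self hW0.le hk'1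
  have hP₀W : P₀ ≤ W := div_le_self hW0.le (by linarith)
  have hP₀P : P₀ ≤ P := by rw [hPdef, hP₀]; gcongr
  have hQQ' : Q ≤ Q' := by rw [hQ, hQ']; gcongr
  have hVW : V - W ≤ η / 2 * W := by
    have := sqrt_sub_sqrt_le hT hTT'
    rw [hη]; linarith
  -- `2πW = √(2πT)`, so `A/P₀ = D₁`, `A/Q ≤ D₁`, `A/P ≤ D₁`
  have h2πW : 2 * π * W = Real.sqrt (2 * π * T) := by
    have e : (2 : ℝ) * π * T = (2 * π) ^ 2 * (T / (2 * π)) := by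
      field_simp
    rw [e, Real.sqrt_mul (by positivity), Real.sqrt_sq (by positivity), hW]
  have hAP₀ : A / P₀ = D₁ := by
    rw [hA, hP₀, hD₁, ← h2πW]; field_simp
  have hAQ : A / Q ≤ D₁ := by
    rw [← hAP₀]
    refine div_le_div_of_nonneg_left hA0 hP0pos ?_
    rw [hP₀, hQ]
    exact div_le_div_of_nonneg_left hW0.le hk'R hk'h'R
  have hAP : A / P ≤ D₁ := by
    rw [← hAP₀]; exact div_le_div_of_nonneg_left hA0 hP0pos hP₀P
  -- characterisations of the ranges (for natural `ρ`)
  have cP : ∀ ρ : ℕ, P ≤ ρ ↔ T' ≤ 2 * π * (h' : ℝ) ^ 2 * (ρ : ℝ) ^ 2 := by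
    intro ρ
    rw [hPdef, div_le_iff₀ hh'R, hV, Real.sqrt_le_left (by positivity), div_le_iff₀ (by positivity)]
    · constructor <;> intro h <;> nlinarith [h]
  have cP₀ : ∀ ρ : ℕ, P₀ ≤ ρ ↔ T ≤ 2 * π * (h' : ℝ) ^ 2 * (ρ : ℝ) ^ 2 := by
    intro ρ
    rw [hP₀, div_le_iff₀ hh'R, hW, Real.sqrt_le_left (by positivity), div_le_iff₀ (by positivity)]
    · constructor <;> intro h <;> nlinarith [h]
  have cQ : ∀ ρ : ℕ, (ρ : ℝ) ≤ Q ↔ 2 * π * (k' : ℝ) ^ 2 * (ρ : ℝ) ^ 2 ≤ T := by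
    intro ρ
    rw [hQ, le_div_iff₀ hk'R, hW, Real.le_sqrt (by positivity), le_div_iff₀ (by positivity)]
    · constructor <;> intro h <;> nlinarith [h]
    all_goals positivity
  have cQ' : ∀ ρ : ℕ, (ρ : ℝ) ≤ Q' ↔ 2 * π * (k' : ℝ) ^ 2 * (ρ : ℝ) ^ 2 ≤ T' := by
    intro ρ
    rw [hQ', le_div_iff₀ hk'R, hV, Real.le_sqrt (by positivity), le_div_iff₀ (by positivity)]
    · constructor <;> intro h <;> nlinarith [h]
    all_goals positivity
  -- abbreviation for the summand
  set card : ℕ → ℝ := fun ρ => ((wedgeNu T T' X h' k' ρ).card : ℝ) with hcard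
  have hcard0 : ∀ ρ, 0 ≤ card ρ := fun ρ => Nat.cast_nonneg _
  have hcard_le : ∀ ρ : ℕ, 0 < ρ → card ρ ≤ A / ρ + 1 := by
    intro ρ hρ
    have := card_wedgeNu_le hT hTT' X hh' k' hρ
    rw [hcard, hA]; simpa [sub_div] using this
  -- split `[1, X]` into low / mid / high
  set S := Finset.Icc 1 X with hS
  set low : ℕ → Prop := fun ρ => 2 * π * (h' : ℝ) ^ 2 * (ρ : ℝ) ^ 2 < T' with hlow
  set midc : ℕ → Prop := fun ρ => 2 * π * (k' : ℝ) ^ 2 * (ρ : ℝ) ^ 2 ≤ T with hmidc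
  have hsplit : ∑ ρ ∈ S, card ρ = ∑ ρ ∈ S.filter low, card ρ +
      (∑ ρ ∈ (S.filter (fun ρ => ¬ low ρ)).filter midc, card ρ +
        ∑ ρ ∈ (S.filter (fun ρ => ¬ low ρ)).filter (fun ρ => ¬ midc ρ), card ρ) := by
    rw [Finset.sum_filter_add_sum_filter_not, Finset.sum_filter_add_sum_filter_not]
  -- the middle set is `{ρ ∈ [1,X] : P ≤ ρ ≤ Q}`
  have hMid : (S.filter (fun ρ => ¬ low ρ)).filter midc = S.filter (fun ρ : ℕ => P ≤ ρ ∧ (ρ : ℝ) ≤ Q) := by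
    ext ρ
    simp only [Finset.mem_filter]
    constructor
    · rintro ⟨⟨hS', hnl⟩, hm⟩
      exact ⟨hS', (cP ρ).2 (not_lt.1 hnl), (cQ ρ).2 hm⟩
    · rintro ⟨hS', h1, h2⟩
      exact ⟨⟨hS', not_lt.2 ((cP ρ).1 h1)⟩, (cQ ρ).1 h2⟩
  ----------------------------------------------------------------
  -- (1) middle: `|S_mid − A Σ 1/ρ| ≤ X`
  ----------------------------------------------------------------
  have hmid_pt : ∀ ρ ∈ S.filter (fun ρ : ℕ => P ≤ ρ ∧ (ρ : ℝ) ≤ Q), |card ρ - A / ρ| ≤ 1 := by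
    intro ρ hρ
    rw [Finset.mem_filter] at hρ
    obtain ⟨hρS, hPρ, hρQ⟩ := hρ
    have hρ1 : 1 ≤ ρ := (Finset.mem_Icc.1 hρS).1
    have hρR : (0 : ℝ) < ρ := by exact_mod_cast hρ1
    have hstrip := wedgeNu_eq_strip (T := T) (T' := T') (X := X) (k' := k') hh' hρ1
      ((cP ρ).1 hPρ) ((cQ ρ).1 hρQ)
    -- `U = a'/ρ ≤ a'/P = V < X + 1`
    have hL : 0 < T / (2 * π * h') / ρ := by positivity
    have hLU : T / (2 * π * h') / ρ ≤ T' / (2 * π * h') / ρ := by gcongr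
    have hU : T' / (2 * π * h') / ρ < X + 1 := by
      have h1 : T' / (2 * π * h') / ρ ≤ T' / (2 * π * h') / P :=
        div_le_div_of_nonneg_left (by positivity) hP0' hPρ
      have h2 : T' / (2 * π * h') / P = V := by
        have hT'eq : T' = 2 * π * V ^ 2 := by rw [hV2]; field_simp
        rw [hPdef, hT'eq]
        field_simp
      linarith
    have hc := card_filter_real_Icc hL hLU hU
    rw [hcard]
    simp only []
    rw [hstrip]
    have e : T' / (2 * π * h') / ρ - T / (2 * π * h') / ρ = A / ρ := by rw [hA]; ring
    rw [abs_le]; constructor <;> linarith [hc.1, hc.2]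
  have hmid : |∑ ρ ∈ (S.filter (fun ρ => ¬ low ρ)).filter midc, card ρ -
      A * ∑ ρ ∈ S.filter (fun ρ : ℕ => P ≤ ρ ∧ (ρ : ℝ) ≤ Q), 1 / (ρ : ℝ)| ≤ V := by
    rw [hMid, Finset.mul_sum, ← Finset.sum_sub_distrib]
    refine (Finset.abs_sum_le_sum_abs _ _).trans ?_
    calc ∑ ρ ∈ S.filter (fun ρ : ℕ => P ≤ ρ ∧ (ρ : ℝ) ≤ Q), |card ρ - A * (1 / (ρ : ℝ))|
        ≤ ∑ ρ ∈ S.filter (fun ρ : ℕ => P ≤ ρ ∧ (ρ : ℝ) ≤ Q), (1 : ℝ) :=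
          Finset.sum_le_sum fun ρ hρ => by rw [mul_one_div]; exact hmid_pt ρ hρ
      _ = ((S.filter (fun ρ : ℕ => P ≤ ρ ∧ (ρ : ℝ) ≤ Q)).card : ℝ) := by simp
      _ ≤ (S.card : ℝ) := by exact_mod_cast Finset.card_filter_le _ _
      _ = X := by rw [hS, Nat.card_Icc]; simp
      _ ≤ V := hXV'
  ----------------------------------------------------------------
  -- (2) the harmonic sum: `|Σ_mid 1/ρ − log(Q/P)| ≤ 5/P + η/2`
  ----------------------------------------------------------------
  have hlogWV : |Real.log (W / V)| ≤ η / 2 := by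
    have h1 : Real.log (W / V) ≤ 0 := Real.log_nonpos (by positivity) (by rw [div_le_one hV0]; exact hWV)
    have h2 : -(η / 2) ≤ Real.log (W / V) := by
      rw [Real.log_div hW0.ne' hV0.ne']
      have : Real.log V - Real.log W ≤ η / 2 := by
        rw [← Real.log_div hV0.ne' hW0.ne']
        refine (Real.log_le_sub_one_of_pos (by positivity)).trans ?_
        rw [div_sub_one hW0.ne', div_le_iff₀ hW0]
        linarith
      linarith
    rw [abs_le]; constructor <;> linarith
  have hlogQP : Real.log (Q / P) = Real.log ((h' : ℝ) / k') + Real.log (W / V) := by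
    rw [← Real.log_mul (by positivity) (by positivity)]
    congr 1
    rw [hQ, hPdef]; field_simp
  have hharm : |∑ ρ ∈ S.filter (fun ρ : ℕ => P ≤ ρ ∧ (ρ : ℝ) ≤ Q), 1 / (ρ : ℝ) - Real.log (Q / P)| ≤
      5 / P + η / 2 := by
    rcases le_or_gt P Q with hPQ | hQP
    · have hQX : Q < X + 1 := by linarith
      have := abs_sum_mid_inv_sub_log_le (X := X) hP2 hPQ hQX
      linarith
    · -- empty middle range: `Q < P`, and `log(h'/k') ≥ 0` forces `|log(Q/P)| ≤ |log(W/V)|`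
      have hempty : S.filter (fun ρ : ℕ => P ≤ ρ ∧ (ρ : ℝ) ≤ Q) = ∅ := by
        rw [Finset.filter_eq_empty_iff]; intro ρ _ h; linarith [h.1, h.2]
      rw [hempty, Finset.sum_empty, zero_sub, abs_neg]
      have hneg : Real.log (Q / P) < 0 := Real.log_neg (by positivity) (by rw [div_lt_one hP0']; exact hQP)
      have hhk : 0 ≤ Real.log ((h' : ℝ) / k') := Real.log_nonneg (by rw [le_div_iff₀ hk'R]; linarith)
      rw [abs_of_neg hneg]
      have : -Real.log (W / V) ≤ η / 2 := by linarith [(abs_le.1 hlogWV).1]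
      have h5 : 0 ≤ 5 / P := by positivity
      linarith
  ----------------------------------------------------------------
  -- (3) low range: `S_low ≤ (η/2)A + (η/2)P₀ + D₁ + 1`
  ----------------------------------------------------------------
  have hlowsum : ∑ ρ ∈ S.filter low, card ρ ≤ η / 2 * A + η / 2 * P₀ + D₁ + 1 := by
    -- pointwise: `card ρ ≤ [P₀ ≤ ρ](A/P₀ + 1)`
    have hpt : ∀ ρ ∈ S.filter low, card ρ ≤
        if P₀ ≤ ρ then A / P₀ + 1 else 0 := by
      intro ρ hρ
      rw [Finset.mem_filter] at hρ
      have hρ1 : 1 ≤ ρ := (Finset.mem_Icc.1 hρ.1).1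
      have hρR : (0 : ℝ) < ρ := by exact_mod_cast hρ1
      split_ifs with hP₀ρ
      · refine (hcard_le ρ hρ1).trans ?_
        gcongr
      · rw [hcard]
        simp only []
        rw [wedgeNu_eq_empty hh' (Or.inl (by
          have := (cP₀ ρ).not.1 hP₀ρ; push Not at this; exact this)), Finset.card_empty, Nat.cast_zero]
    refine (Finset.sum_le_sum hpt).trans ?_
    rw [← Finset.sum_filter, Finset.sum_const, nsmul_eq_mul]
    -- the number of `ρ ∈ low` with `P₀ ≤ ρ` is `≤ P − P₀ + 1 ≤ (η/2)P₀ + 1`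
    have hsub : (S.filter low).filter (fun ρ : ℕ => P₀ ≤ ρ) ⊆
        S.filter (fun ρ : ℕ => P₀ ≤ ρ ∧ (ρ : ℝ) ≤ P) := by
      intro ρ hρ
      simp only [Finset.mem_filter] at hρ ⊢
      refine ⟨hρ.1.1, hρ.2, ?_⟩
      have := (cP ρ).not.2 (not_le.2 hρ.1.2)
      linarith [not_le.1 this]
    have hcnt : ((((S.filter low).filter (fun ρ : ℕ => P₀ ≤ ρ)).card : ℕ) : ℝ) ≤ η / 2 * P₀ + 1 := by
      have h1 := Finset.card_le_card hsub
      have h2 := card_filter_real_le (L := P₀) (U := P) X hP0pos hP₀P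
      have h3 : P - P₀ ≤ η / 2 * P₀ := by
        rw [hPdef, hP₀, ← sub_div, div_le_iff₀ hh'R]
        calc V - W ≤ η / 2 * W := hVW
          _ = η / 2 * (W / h') * h' := by field_simp
      calc ((((S.filter low).filter (fun ρ : ℕ => P₀ ≤ ρ)).card : ℕ) : ℝ) ≤
          ((S.filter (fun ρ : ℕ => P₀ ≤ ρ ∧ (ρ : ℝ) ≤ P)).card : ℝ) := by exact_mod_cast h1
        _ ≤ P - P₀ + 1 := h2
        _ ≤ η / 2 * P₀ + 1 := by linarith
    have hAP₀' : 0 ≤ A / P₀ + 1 := by positivity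
    calc ((((S.filter low).filter (fun ρ : ℕ => P₀ ≤ ρ)).card : ℕ) : ℝ) * (A / P₀ + 1)
        ≤ (η / 2 * P₀ + 1) * (A / P₀ + 1) := mul_le_mul_of_nonneg_right hcnt hAP₀'
      _ = η / 2 * A + η / 2 * P₀ + A / P₀ + 1 := by field_simp; ring
      _ = η / 2 * A + η / 2 * P₀ + D₁ + 1 := by rw [hAP₀]
  ----------------------------------------------------------------
  -- (4) high range: `S_high ≤ (η/2)A + (η/2)Q + D₁ + 1`
  ----------------------------------------------------------------
  have hhighsum : ∑ ρ ∈ (S.filter (fun ρ => ¬ low ρ)).filter (fun ρ => ¬ midc ρ), card ρ ≤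
      η / 2 * A + η / 2 * Q + D₁ + 1 := by
    have hpt : ∀ ρ ∈ (S.filter (fun ρ => ¬ low ρ)).filter (fun ρ => ¬ midc ρ), card ρ ≤
        if (ρ : ℝ) ≤ Q' then A / Q + 1 else 0 := by
      intro ρ hρ
      simp only [Finset.mem_filter] at hρ
      have hρ1 : 1 ≤ ρ := (Finset.mem_Icc.1 hρ.1.1).1
      have hρR : (0 : ℝ) < ρ := by exact_mod_cast hρ1
      have hQρ : Q < ρ := by
        have := (cQ ρ).not.2 hρ.2
        exact not_le.1 this
      split_ifs with hρQ'
      · refine (hcard_le ρ hρ1).trans ?_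
        gcongr
      · rw [hcard]
        simp only []
        rw [wedgeNu_eq_empty hh' (Or.inr (by
          have := (cQ' ρ).not.1 hρQ'; push Not at this; exact this)), Finset.card_empty, Nat.cast_zero]
    refine (Finset.sum_le_sum hpt).trans ?_
    rw [← Finset.sum_filter, Finset.sum_const, nsmul_eq_mul]
    have hsub : ((S.filter (fun ρ => ¬ low ρ)).filter (fun ρ => ¬ midc ρ)).filter (fun ρ : ℕ => (ρ : ℝ) ≤ Q') ⊆
        S.filter (fun ρ : ℕ => Q ≤ ρ ∧ (ρ : ℝ) ≤ Q') := by
      intro ρ hρ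
      simp only [Finset.mem_filter] at hρ ⊢
      refine ⟨hρ.1.1.1, ?_, hρ.2⟩
      have := (cQ ρ).not.2 hρ.1.2
      exact (not_le.1 this).le
    have hcnt : (((((S.filter (fun ρ => ¬ low ρ)).filter (fun ρ => ¬ midc ρ)).filter
        (fun ρ : ℕ => (ρ : ℝ) ≤ Q')).card : ℕ) : ℝ) ≤ η / 2 * Q + 1 := by
      have h1 := Finset.card_le_card hsub
      have h2 := card_filter_real_le (L := Q) (U := Q') X hQpos hQQ'
      have h3 : Q' - Q ≤ η / 2 * Q := by
        rw [hQ', hQ, ← sub_div, div_le_iff₀ hk'R]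
        calc V - W ≤ η / 2 * W := hVW
          _ = η / 2 * (W / k') * k' := by field_simp
      calc (((((S.filter (fun ρ => ¬ low ρ)).filter (fun ρ => ¬ midc ρ)).filter
          (fun ρ : ℕ => (ρ : ℝ) ≤ Q')).card : ℕ) : ℝ)
          ≤ ((S.filter (fun ρ : ℕ => Q ≤ ρ ∧ (ρ : ℝ) ≤ Q')).card : ℝ) := by exact_mod_cast h1
        _ ≤ Q' - Q + 1 := h2
        _ ≤ η / 2 * Q + 1 := by linarith
    have hAQ' : 0 ≤ A / Q + 1 := by positivity
    calc (((((S.filter (fun ρ => ¬ low ρ)).filter (fun ρ => ¬ midc ρ)).filter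
          (fun ρ : ℕ => (ρ : ℝ) ≤ Q')).card : ℕ) : ℝ) * (A / Q + 1)
        ≤ (η / 2 * Q + 1) * (A / Q + 1) := mul_le_mul_of_nonneg_right hcnt hAQ'
      _ = η / 2 * A + η / 2 * Q + A / Q + 1 := by field_simp; ring
      _ ≤ η / 2 * A + η / 2 * Q + D₁ + 1 := by linarith
  ----------------------------------------------------------------
  -- (5) assemble
  ----------------------------------------------------------------
  have hfinal : |∑ ρ ∈ S, card ρ - A * Real.log ((h' : ℝ) / k')| ≤
      2 * η * A + 7 * D₁ + 2 * V + 2 := by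
    set Smid := ∑ ρ ∈ (S.filter (fun ρ => ¬ low ρ)).filter midc, card ρ
    set Slow := ∑ ρ ∈ S.filter low, card ρ
    set Shigh := ∑ ρ ∈ (S.filter (fun ρ => ¬ low ρ)).filter (fun ρ => ¬ midc ρ), card ρ
    set Hm := ∑ ρ ∈ S.filter (fun ρ : ℕ => P ≤ ρ ∧ (ρ : ℝ) ≤ Q), 1 / (ρ : ℝ)
    have hSlow0 : 0 ≤ Slow := Finset.sum_nonneg fun ρ _ => hcard0 ρ
    have hShigh0 : 0 ≤ Shigh := Finset.sum_nonneg fun ρ _ => hcard0 ρ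
    have e : ∑ ρ ∈ S, card ρ - A * Real.log ((h' : ℝ) / k') =
        (Smid - A * Hm) + A * (Hm - Real.log (Q / P)) + A * Real.log (W / V) + Slow + Shigh := by
      rw [hsplit, hlogQP]; ring
    rw [e]
    have t1 := hmid
    have t2 : |A * (Hm - Real.log (Q / P))| ≤ A * (5 / P + η / 2) := by
      rw [abs_mul, abs_of_nonneg hA0]; exact mul_le_mul_of_nonneg_left hharm hA0
    have t3 : |A * Real.log (W / V)| ≤ A * (η / 2) := by
      rw [abs_mul, abs_of_nonneg hA0]; exact mul_le_mul_of_nonneg_left hlogWV hA0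
    have t4 : A * (5 / P) ≤ 5 * D₁ := by
      have : A * (5 / P) = 5 * (A / P) := by ring
      rw [this]; linarith
    have hPQW : η / 2 * P₀ + η / 2 * Q ≤ V := by
      have : η / 2 * P₀ + η / 2 * Q ≤ 1 / 2 * W + 1 / 2 * W := by
        gcongr
      linarith
    calc |Smid - A * Hm + A * (Hm - Real.log (Q / P)) + A * Real.log (W / V) + Slow + Shigh|
        ≤ |Smid - A * Hm| + |A * (Hm - Real.log (Q / P))| + |A * Real.log (W / V)| + Slow + Shigh := by
          have := abs_add_le (Smid - A * Hm + A * (Hm - Real.log (Q / P)) + A * Real.log (W / V) + Slow) Shigh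
          have := abs_add_le (Smid - A * Hm + A * (Hm - Real.log (Q / P)) + A * Real.log (W / V)) Slow
          have := abs_add_le (Smid - A * Hm + A * (Hm - Real.log (Q / P))) (A * Real.log (W / V))
          have := abs_add_le (Smid - A * Hm) (A * (Hm - Real.log (Q / P)))
          rw [abs_of_nonneg hSlow0, abs_of_nonneg hShigh0] at *
          linarith
      _ ≤ V + A * (5 / P + η / 2) + A * (η / 2) + (η / 2 * A + η / 2 * P₀ + D₁ + 1) +
          (η / 2 * A + η / 2 * Q + D₁ + 1) := by linarith
      _ ≤ 2 * η * A + 7 * D₁ + 2 * V + 2 := by nlinarith [t4, hPQW]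
  -- translate back to the statement
  have e1 : 2 * ((T' - T) / T) * ((T' - T) / (2 * π * h')) + 7 * ((T' - T) / Real.sqrt (2 * π * T)) +
      2 * Real.sqrt (T' / (2 * π)) + 2 = 2 * η * A + 7 * D₁ + 2 * V + 2 := by
    rw [hη, hA, hD₁, hV]
  rw [e1]
  convert hfinal using 2

end Literature.NumberTheory.LFunctions.BCH
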